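import Mathlib
import HarnessLib

/-!
# Composing a one-variable clause with the sum of the variables (`stub_sumCompositionClause`)

Line `Sketch` of crux `DiophantineDichotomy.KhovanskiiApproxTypeEv` (stmt-Schanuel-14972), registered stub
`stub_sumCompositionClause` of skeleton v10 (sub-goal E, the bookkeeping feeding Ably's 1994 measure of
algebraic independence): for a non-zero `P ∈ ℤ[x]` of degree `≤ D` and naive height `≤ H` and `n ≥ 1`,
the composition `Q := P ∘ (x₁ + ⋯ + xₙ) ∈ ℤ[x₁, …, xₙ]` is non-zero, has total degree `≤ D`, naive height
`≤ n^D (D+1) H`, and evaluates to `P(∑ xᵢ)` at every complex point.  The witness is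
`Polynomial.aeval (∑ i, X i) P`; non-vanishing is seen by substituting `x₁ ↦ x`, `xᵢ ↦ 0 (i ≥ 2)`, which
returns `P`; the height bound is the multinomial theorem (`MvPolynomial.coeff_sum_X_pow_of_fintype`):
the coefficients of `(x₁ + ⋯ + xₙ)^j` are multinomial coefficients, each at most their sum `n^j`.
Everything here is proved from Mathlib; no named facts.
-/

noncomputable section

set_option linter.dupNamespace false -- mandated summit/sub-problem namespace (single-conjunct summit)

namespace Summit.Schanuel.Schanuel.Cruxes.KhovanskiiApproxTypeEv.AnchoredReduction

open Polynomial MvPolynomial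

/-- A multinomial coefficient of weight `j` on `Fin n` is at most `n ^ j` (it is one term of the
multinomial expansion of `(1 + ⋯ + 1)^j = n^j`). [folklore] -/
theorem sumComp_multinomial_le {n : ℕ} (m : Fin n →₀ ℕ) :
    m.multinomial ≤ n ^ (m.sum fun _ e => e) := by
  classical
  have hmem : (⇑m : Fin n → ℕ) ∈ Finset.piAntidiag Finset.univ (m.sum fun _ e => e) := by
    rw [Finset.mem_piAntidiag]
    refine ⟨?_, fun i _ => Finset.mem_univ i⟩
    rw [Finsupp.sum_fintype]
    intro
    rfl
  have hsum := Finset.sum_pow_eq_sum_piAntidiag (Finset.univ : Finset (Fin n)) (fun _ => (1 : ℕ))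
    (m.sum fun _ e => e)
  simp only [Finset.sum_const, Finset.card_univ, Fintype.card_fin, smul_eq_mul, mul_one, one_pow,
    Finset.prod_const_one] at hsum
  rw [hsum, Finsupp.multinomial_eq_of_support_subset (Finset.subset_univ m.support)]
  exact Finset.single_le_sum (f := fun k => Nat.multinomial Finset.univ k) (fun _ _ => Nat.zero_le _)
    hmem

/-- The coefficients of `(x₁ + ⋯ + xₙ)^j ∈ ℤ[x₁, …, xₙ]` are bounded by `n ^ j` in absolute value.
[folklore] -/
theorem sumComp_abs_coeff_sum_X_pow_le {n : ℕ} (m : Fin n →₀ ℕ) (j : ℕ) :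
    |MvPolynomial.coeff m ((∑ i : Fin n, MvPolynomial.X i : MvPolynomial (Fin n) ℤ) ^ j)| ≤
      (n : ℤ) ^ j := by
  rw [MvPolynomial.coeff_sum_X_pow_of_fintype]
  split_ifs with h
  · rw [Nat.abs_cast, ← h]
    exact_mod_cast sumComp_multinomial_le m
  · rw [Nat.cast_zero, abs_zero]
    positivity

/-- The linear form `x₁ + ⋯ + xₙ ∈ ℤ[x₁, …, xₙ]` has total degree at most `1`. [folklore] -/
theorem sumComp_totalDegree_sum_X_le (n : ℕ) :
    (∑ i : Fin n, MvPolynomial.X i : MvPolynomial (Fin n) ℤ).totalDegree ≤ 1 :=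
  MvPolynomial.totalDegree_finsetSum_le fun i _ => (MvPolynomial.totalDegree_X (R := ℤ) i).le

/-- **`stub_sumCompositionClause` — SUB-GOAL E** (registered stub of line `Sketch`, skeleton v10):
composing a one-variable integer clause with the sum of the variables — for `n ≥ 1` and a non-zero
`P ∈ ℤ[x]` of degree `≤ D` and naive height `≤ H`, `Q := P ∘ (x₁ + ⋯ + xₙ)` is a non-zero integer
polynomial in `n` variables of total degree `≤ D` and naive height `≤ n^D (D+1) H`, with
`Q(x) = P(∑ xᵢ)` at every `x ∈ ℂⁿ`. [folklore] -/
theorem stub_sumCompositionClause (n D H : ℕ) (hn : 1 ≤ n) (P : Polynomial ℤ) (hP : P ≠ 0)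
    (hdeg : P.natDegree ≤ D) (hH : ∀ l, |P.coeff l| ≤ (H : ℤ)) :
    ∃ Q : MvPolynomial (Fin n) ℤ, Q ≠ 0 ∧ Q.totalDegree ≤ D ∧
      (∀ m, |Q.coeff m| ≤ ((n ^ D * (D + 1) * H : ℕ) : ℤ)) ∧
      ∀ x : Fin n → ℂ, MvPolynomial.aeval x Q = Polynomial.aeval (∑ i, x i) P := by
  classical
  set S : MvPolynomial (Fin n) ℤ := ∑ i : Fin n, MvPolynomial.X i with hS
  refine ⟨Polynomial.aeval S P, ?_, ?_, ?_, ?_⟩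
  · -- non-vanishing: substitute `x_{i₀} ↦ x`, `x_i ↦ 0` otherwise; this returns `P`
    intro hQ
    apply hP
    let i₀ : Fin n := ⟨0, hn⟩
    let f : MvPolynomial (Fin n) ℤ →ₐ[ℤ] Polynomial ℤ :=
      MvPolynomial.aeval fun i => if i = i₀ then (Polynomial.X : Polynomial ℤ) else 0
    have hfS : f S = Polynomial.X := by
      simp [f, hS, map_sum, MvPolynomial.aeval_X, Finset.sum_ite_eq']
    have key := Polynomial.aeval_algHom_apply f S P
    rw [hfS, Polynomial.aeval_X_left_apply, hQ, map_zero] at key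
    exact key
  · -- total degree
    rw [Polynomial.aeval_eq_sum_range]
    refine MvPolynomial.totalDegree_finsetSum_le fun j hj => ?_
    have hj' : j ≤ D := (Nat.lt_succ_iff.mp (Finset.mem_range.mp hj)).trans hdeg
    calc (P.coeff j • S ^ j).totalDegree ≤ (S ^ j).totalDegree :=
          MvPolynomial.totalDegree_smul_le _ _
      _ ≤ j * S.totalDegree := MvPolynomial.totalDegree_pow _ _
      _ ≤ j * 1 := Nat.mul_le_mul_left _ (sumComp_totalDegree_sum_X_le n)
      _ ≤ D := by simpa using hj'
  · -- coefficients
    intro m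
    rw [Polynomial.aeval_eq_sum_range, MvPolynomial.coeff_sum]
    have hn1 : (1 : ℤ) ≤ n := by exact_mod_cast hn
    calc |∑ j ∈ Finset.range (P.natDegree + 1), MvPolynomial.coeff m (P.coeff j • S ^ j)|
        ≤ ∑ j ∈ Finset.range (P.natDegree + 1), |MvPolynomial.coeff m (P.coeff j • S ^ j)| :=
          Finset.abs_sum_le_sum_abs _ _
      _ ≤ ∑ _j ∈ Finset.range (P.natDegree + 1), (H : ℤ) * (n : ℤ) ^ D := by
          refine Finset.sum_le_sum fun j hj => ?_
          have hj' : j ≤ D := (Nat.lt_succ_iff.mp (Finset.mem_range.mp hj)).trans hdeg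
          rw [MvPolynomial.coeff_smul, smul_eq_mul, abs_mul]
          exact mul_le_mul (hH j)
            ((sumComp_abs_coeff_sum_X_pow_le m j).trans (pow_le_pow_right₀ hn1 hj'))
            (abs_nonneg _) (by positivity)
      _ = ((P.natDegree + 1 : ℕ) : ℤ) * ((H : ℤ) * (n : ℤ) ^ D) := by
          rw [Finset.sum_const, Finset.card_range, nsmul_eq_mul]
      _ ≤ ((D + 1 : ℕ) : ℤ) * ((H : ℤ) * (n : ℤ) ^ D) :=
          mul_le_mul_of_nonneg_right (by exact_mod_cast Nat.succ_le_succ hdeg) (by positivity)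
      _ = ((n ^ D * (D + 1) * H : ℕ) : ℤ) := by
          push_cast
          ring
  · -- evaluation
    intro x
    rw [← Polynomial.aeval_algHom_apply]
    congr 1
    simp [hS, map_sum, MvPolynomial.aeval_X]

end Summit.Schanuel.Schanuel.Cruxes.KhovanskiiApproxTypeEv.AnchoredReduction

end
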